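import Literature.AlgebraicGeometry.ShimuraVarieties.UnitaryBallGroupIntegral
import Literature.AlgebraicGeometry.ShimuraVarieties.UnitaryBallCauchyRiemann
import Literature.Geometry.ComplexHyperbolic.UnitBallIsotropyBlock
import Literature.Geometry.ComplexHyperbolic.UnitBallIsotropy
import Mathlib.Analysis.SpecialFunctions.SmoothTransition
import HarnessLib

/-!
# The reproducing KERNEL of holomorphic cotangent (`(1,0)`-) forms on `U(2,1)`: a smooth, compactly supported,
# `K`-equivariant matrix kernel `A_κ(u) = (κ·W(u·x₀)) • ((Jac u x₀)ᵀ)⁻¹`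

Topic `AlgebraicGeometry/ShimuraVarieties` (the ball model of `U(2,1)`); namespace `Literature.AlgebraicGeometry.ShimuraVarieties.BallForms`.
DEFINITIONS + theorems, no named fact, no `sorry`, no instance, no notation.  Written for the floor-0 (D) desk of the Hodge cell
(socket `holCotFormSpectralProjection`, road (h) «holomorphic reproduction», stub h1; F0P2-p03 (g2) on F0P2-plan (g2)'s cut and
F0P2-p01 (g2)'s CENSUS-R v2 §6) but entirely about the ball `𝔹² = U(2,1)/K` — it is the KERNEL half; the reproduction identity for
`holCotForms` is the sibling `NumberTheory/Automorphic/UnitaryGroupHolCotFormsReproducing`.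

CONTENT.
* §1 isotropy bookkeeping (★ `UnitBallIsotropyBlock`): the Jacobian of a stabiliser element `k = diag(A,d) ∈ K = U(2)×U(1)` is CONSTANT on
  the ball, `Jac (diag(A,d)) z = d̄ • A` (`Jac_blockU`, `Jac_eq_Jac_x₀_of_mem_stabilizer`), and `K` preserves `|z|²` (`nsq_stabilizer_smul`)
  [Rudin1980, §2.1–2.2: the unitary group acts linearly and isometrically; Jacobowitz 1990, Ch. 2 §1 Lemma 6(2)].
* §2 the kernel: a smooth radial PROFILE `β(t) = smoothTransition(2 − 8t)` (`= 1` on `t ≤ 1/8`, `= 0` on `t ≥ 1/4`; Mathlib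
  `Real.smoothTransition`), the Bergman-compensated BALL WEIGHT `W(z) = β(|z|²) / (9 (1−|z|²)⁻³)` (so that `W dβ = β(|z|²) dv`, `dβ` the
  `U(2,1)`-invariant Bergman volume of ★ `UnitaryBallGroupIntegral`), and the MATRIX KERNEL `A_κ(u) = (κ W(u·x₀)) • coT u x₀` on `U(2,1)`
  (`coT u x₀ = ((Jac u x₀)ᵀ)⁻¹`, ★ `UnitBallJacobian`): continuous (`reproducingKernel_continuous`), supported in the compact set
  `{u : |u·x₀|² ≤ 1/4}` (`reproducingKernel_eq_zero`, `reproducingKernel_hasCompactSupport`, ★ `isCompact_setOf_smul_x₀_mem`), and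
  `K`-EQUIVARIANT for the cotangent weight `τ = weightOf x₀` of ★ `UnitaryBallAutomorphicForms`: `A_κ(k u) · v = τ(k) (A_κ(u) · v)`
  (`reproducingKernel_equivariant`; because `W` is `K`-invariant and `coT (k u) x₀ = (Jac k⁻¹ x₀)ᵀ · coT u x₀`, `coT_stabilizer_mul`).
* §3 the profile constant `C_β = ∫_{ℂ²} β(|w|²) dw > 0` (`profileIntegral_pos`).
* §4 SMOOTHNESS in the currency the (D) desk consumes (parametric differentiation under left translates): `A_κ = Ã_κ ∘ mat` for an
  explicit `Ã_κ : M₃(ℂ) → M₂(ℂ)` (`extKernel`; `reproducingKernel_eq_extKernel`) which is `C^∞` (real) at every point of `mat(U(2,1))`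
  (`contDiffAt_extKernel`: rational functions of the entries — ★ `orbitVec`, `JacAt0`, `coTOf` of `UnitaryBallCauchyRiemann` — with
  non-vanishing denominators `M₂₂ ≠ 0`, `det Jac ≠ 0` there, times the smooth profile of the real-smooth `|·|²`).
HC_CM is proved only modulo the printed citations until rung 0 closes.

## References
* [Rudin1980] W. Rudin, *Function Theory in the Unit Ball of ℂⁿ*, Grundlehren 241 (1980), §1.4 (integration in polar coordinates, mean
  value), §2.1–2.2 and Thm. 2.2.6 (automorphisms of the ball, the invariant measure).
* [Borel1997] A. Borel, *Automorphic forms on SL₂(ℝ)* (1997), §5.14 (forms of a given `K`-type as functions on the group; the automorphy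
  factor and the isotropy representation).
* [Helgason2000] S. Helgason, *Groups and Geometric Analysis* (2000), Ch. I §1 Thm. 1.9 (invariant measures on `G/K`).
-/

set_option autoImplicit false

noncomputable section

open MeasureTheory MulAction Matrix
open scoped Matrix ComplexConjugate ContDiff
open Literature.Geometry.ComplexHyperbolic
open Literature.Geometry.ComplexHyperbolic.BallModel
open Literature.NumberTheory.Automorphic.U21 (K21 matA sclD star_sclD_mul_self conjTranspose_matA_mul_self)
open Literature.NumberTheory.Automorphic.AutomorphyFactor

namespace Literature.AlgebraicGeometry.ShimuraVarieties.BallForms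

/-! ## §1 Isotropy bookkeeping: the Jacobian of a stabiliser element is constant; `K` preserves `|z|²` -/

/-- `(diag(A,d) · (z,1))_k`: the first two coordinates are `(A z)_i`, the last is `d`. [cite: Borel1997, §5.14] -/
theorem W3_blockU (k : K21) (z : Ball) :
    W3 (blockU k) z 2 = sclD k ∧
      ∀ i : Fin 2, W3 (blockU k) z (Fin.castSucc i) = (matA k *ᵥ z.1) i := by
  refine ⟨?_, fun i => ?_⟩
  · rw [W3_apply, mat_blockU]; simp [bmat]
  · rw [W3_apply, mat_blockU]
    fin_cases i <;> simp [bmat, Matrix.mulVec, dotProduct, Fin.sum_univ_two]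

/-- **The Jacobian of `diag(A,d)` is CONSTANT on the ball**: `Jac (diag(A,d)) z = d̄ • A` for every `z`. [cite: Borel1997, §5.14] -/
theorem Jac_blockU (k : K21) (z : Ball) : Jac (blockU k) z = star (sclD k) • matA k := by
  have hd : star (sclD k) * sclD k = 1 := star_sclD_mul_self k
  have hd0 : sclD k ≠ 0 := fun h => by simp [h] at hd
  obtain ⟨h2, hi⟩ := W3_blockU k z
  ext i j
  simp only [Jac, Matrix.of_apply, h2, mat_blockU, Matrix.smul_apply, smul_eq_mul]
  have hij : bmat (matA k) (sclD k) (Fin.castSucc i) (Fin.castSucc j) = matA k i j := by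
    fin_cases i <;> fin_cases j <;> simp [bmat]
  have h2j : bmat (matA k) (sclD k) 2 (Fin.castSucc j) = 0 := by
    fin_cases j <;> simp [bmat]
  rw [hij, h2j, mul_zero, sub_zero]
  have hs : star (sclD k) = (sclD k)⁻¹ := eq_inv_of_mul_eq_one_left hd
  rw [hs]
  field_simp

/-- The Jacobian of a stabiliser element does not depend on the point. [cite: Borel1997, §5.14] -/
theorem Jac_eq_Jac_x₀_of_mem_stabilizer (k : stabilizer U21 x₀) (z : Ball) :
    Jac (k : U21) z = Jac (k : U21) x₀ := by
  obtain ⟨k', hk'⟩ := blockK_surjective k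
  rw [← hk', coe_blockK, Jac_blockU, Jac_blockU]

/-- `K = Stab(x₀)` preserves `|z|²`. [cite: Borel1997, §5.14] -/
theorem nsq_stabilizer_smul (k : stabilizer U21 x₀) (z : Ball) : nsq ((k : U21) • z).1 = nsq z.1 := by
  obtain ⟨k', hk'⟩ := blockK_surjective k
  rw [← hk', coe_blockK]
  obtain ⟨h2, hi⟩ := W3_blockU k' z
  have hd : star (sclD k') * sclD k' = 1 := star_sclD_mul_self k'
  have hnd : ‖sclD k'‖ = 1 := by
    have := congrArg (fun w : ℂ => ‖w‖) hd
    simp only [norm_mul, Complex.star_def, Complex.norm_conj, norm_one] at this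
    nlinarith [norm_nonneg (sclD k')]
  have hval : ∀ i : Fin 2, (blockU k' • z).1 i = (matA k' *ᵥ z.1) i / sclD k' := fun i => by
    rw [smul_val, hi i, h2]
  -- `‖A v‖² = ‖v‖²` for unitary `A`
  have hA : (matA k' : Matrix (Fin 2) (Fin 2) ℂ)ᴴ * matA k' = 1 := conjTranspose_matA_mul_self k'
  have key : nsq (matA k' *ᵥ z.1) = nsq z.1 := by
    have h := nsq_eq (matA k' *ᵥ z.1)
    have h' := nsq_eq z.1
    have hdot : star (matA k' *ᵥ z.1) ⬝ᵥ (matA k' *ᵥ z.1) = star z.1 ⬝ᵥ z.1 := by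
      rw [star_mulVec, ← dotProduct_mulVec, mulVec_mulVec, hA, one_mulVec]
    have e1 : ((nsq (matA k' *ᵥ z.1) : ℝ) : ℂ) = star (matA k' *ᵥ z.1) ⬝ᵥ (matA k' *ᵥ z.1) := by
      rw [h]; simp [dotProduct, Fin.sum_univ_two]
    have e2 : ((nsq z.1 : ℝ) : ℂ) = star z.1 ⬝ᵥ z.1 := by
      rw [h']; simp [dotProduct, Fin.sum_univ_two]
    exact_mod_cast e1.trans (hdot.trans e2.symm)
  have hn : nsq (blockU k' • z).1 = nsq (matA k' *ᵥ z.1) := by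
    unfold nsq
    rw [hval 0, hval 1, norm_div, norm_div, hnd, div_one, div_one]
  rw [hn, key]

/-! ## §2 The kernel: radial profile, Bergman-compensated ball weight, matrix kernel on `U(2,1)` -/

/-- **The radial profile** `β(t) = smoothTransition (2 − 8t)`: smooth on `ℝ`, `= 1` for `t ≤ 1/8`, `= 0` for `t ≥ 1/4`,
values in `[0,1]`. [cite: Borel1997, §5.14] -/
def bumpProfile (t : ℝ) : ℝ := Real.smoothTransition (2 - 8 * t)

/-- the profile is smooth. [cite: Rudin1980, §1.4] -/
theorem bumpProfile_contDiff {n : ℕ∞} : ContDiff ℝ n bumpProfile :=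
  Real.smoothTransition.contDiff.comp (contDiff_const.sub (contDiff_const.mul contDiff_id))

/-- the profile is continuous. [cite: Rudin1980, §1.4] -/
theorem bumpProfile_continuous : Continuous bumpProfile := (bumpProfile_contDiff (n := 0)).continuous

/-- the profile is non-negative. [cite: Rudin1980, §1.4] -/
theorem bumpProfile_nonneg (t : ℝ) : 0 ≤ bumpProfile t := Real.smoothTransition.nonneg _

/-- the profile is at most `1`. [cite: Rudin1980, §1.4] -/
theorem bumpProfile_le_one (t : ℝ) : bumpProfile t ≤ 1 := Real.smoothTransition.le_one _

/-- the profile vanishes for `t ≥ 1/4`. [cite: Rudin1980, §1.4] -/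
theorem bumpProfile_eq_zero {t : ℝ} (ht : 1 / 4 ≤ t) : bumpProfile t = 0 :=
  Real.smoothTransition.zero_of_nonpos (by linarith)

/-- the profile is `1` for `t ≤ 1/8`. [cite: Rudin1980, §1.4] -/
theorem bumpProfile_eq_one {t : ℝ} (ht : t ≤ 1 / 8) : bumpProfile t = 1 :=
  Real.smoothTransition.one_of_one_le (by linarith)

/-- **The ball weight** `W(z) = β(|z|²) / (9 (1 − |z|²)⁻³) = β(|z|²) (1 − |z|²)³ / 9`: the radial profile compensated
by the Bergman density, so that `W dβ = β(|z|²) dv`. [cite: Borel1997, §5.14] -/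
def ballWeight (z : Ball) : ℝ := bumpProfile (nsq z.1) / bergmanDensity z

/-- `z ↦ |z|²` is continuous on the ball. [cite: Rudin1980, §1.4] -/
theorem continuous_nsq_coe : Continuous fun z : Ball => nsq z.1 := by
  have h0 : Continuous fun z : Ball => (z.1 : Fin 2 → ℂ) 0 := (continuous_apply 0).comp continuous_subtype_val
  have h1 : Continuous fun z : Ball => (z.1 : Fin 2 → ℂ) 1 := (continuous_apply 1).comp continuous_subtype_val
  unfold nsq
  exact (h0.norm.pow 2).add (h1.norm.pow 2)

/-- the ball weight is continuous. [cite: Rudin1980, Thm. 2.2.6] -/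
theorem ballWeight_continuous : Continuous ballWeight := by
  unfold ballWeight
  exact (bumpProfile_continuous.comp continuous_nsq_coe).div BallForms.continuous_bergmanDensity
    fun z => (bergmanDensity_pos z).ne'

/-- the ball weight vanishes for `|z|² ≥ 1/4`. [cite: Rudin1980, §1.4] -/
theorem ballWeight_eq_zero {z : Ball} (hz : 1 / 4 ≤ nsq z.1) : ballWeight z = 0 := by
  rw [ballWeight, bumpProfile_eq_zero hz, zero_div]

/-- `W(z) · (9 (1−|z|²)⁻³) = β(|z|²)`: the weight compensates the Bergman density. [cite: Rudin1980, Thm. 2.2.6] -/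
theorem ballWeight_mul_bergmanDensity (z : Ball) :
    ballWeight z * bergmanDensity z = bumpProfile (nsq z.1) :=
  div_mul_cancel₀ _ (bergmanDensity_pos z).ne'

/-- `K` preserves the ball weight. [cite: Borel1997, §5.14] -/
theorem ballWeight_stabilizer_smul (k : stabilizer U21 x₀) (z : Ball) : ballWeight ((k : U21) • z) = ballWeight z := by
  unfold ballWeight bergmanDensity
  rw [nsq_stabilizer_smul]

/-- **The matrix kernel** `A_κ(u) = (κ · W(u·x₀)) • coT u x₀` on `U(2,1)` (`coT u x₀ = ((Jac u x₀)ᵀ)⁻¹`, the inverse of the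
cotangent cocycle at the origin). [cite: Borel1997, §5.14] -/
def reproducingKernel (κ : ℝ) (u : U21) : Matrix (Fin 2) (Fin 2) ℂ :=
  (((κ * ballWeight (u • x₀) : ℝ) : ℂ)) • coT u x₀

/-- the orbit map `u ↦ u·x₀` is continuous. [cite: Helgason2000, Ch. I §1 Thm. 1.9] -/
theorem continuous_smul_x₀ : Continuous fun u : U21 => u • x₀ := continuous_id.smul continuous_const

/-- **the kernel is continuous** on `U(2,1)`. [cite: Borel1997, §5.14] -/
theorem reproducingKernel_continuous (κ : ℝ) : Continuous (reproducingKernel κ) := by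
  have h : Continuous fun u : U21 => ((κ * ballWeight (u • x₀) : ℝ) : ℂ) :=
    Complex.continuous_ofReal.comp (continuous_const.mul (ballWeight_continuous.comp continuous_smul_x₀))
  unfold reproducingKernel
  exact h.smul (continuous_coT x₀)

/-- the closed Euclidean ball `{|z|² ≤ 1/4}` is compact in `𝔹²`. [cite: Borel1997, §5.14] -/
theorem isCompact_setOf_nsq_le_quarter : IsCompact {z : Ball | nsq z.1 ≤ 1 / 4} := by
  rw [isOpenEmbedding_coe.isCompact_iff]
  have himg : (fun z : Ball => (z.1 : Fin 2 → ℂ)) '' {z : Ball | nsq z.1 ≤ 1 / 4} =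
      {w : Fin 2 → ℂ | nsq w ≤ 1 / 4} := by
    ext w
    constructor
    · rintro ⟨z, hz, rfl⟩; exact hz
    · intro hw; exact ⟨⟨w, by simp only [Set.mem_setOf_eq] at hw; linarith⟩, hw, rfl⟩
  rw [himg]
  refine (isCompact_closedBall (0 : Fin 2 → ℂ) 1).of_isClosed_subset (isClosed_le (by unfold nsq; fun_prop)
    continuous_const) fun w hw => ?_
  rw [Metric.mem_closedBall, dist_zero_right, pi_norm_le_iff_of_nonneg zero_le_one]
  intro i
  simp only [Set.mem_setOf_eq, nsq] at hw
  fin_cases i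
  · show ‖w 0‖ ≤ 1
    nlinarith [norm_nonneg (w 0), norm_nonneg (w 1)]
  · show ‖w 1‖ ≤ 1
    nlinarith [norm_nonneg (w 0), norm_nonneg (w 1)]

/-- **the kernel vanishes off `{u : |u·x₀|² ≤ 1/4}`** (an explicit compact set, `isCompact_setOf_smul_x₀_mem isCompact_setOf_nsq_le_quarter`). [cite: Borel1997, §5.14] -/
theorem reproducingKernel_eq_zero {κ : ℝ} {u : U21} (hu : 1 / 4 ≤ nsq (u • x₀).1) : reproducingKernel κ u = 0 := by
  rw [reproducingKernel, ballWeight_eq_zero hu, mul_zero, Complex.ofReal_zero, zero_smul]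

/-- **the kernel has compact support.** [cite: Borel1997, §5.14] -/
theorem reproducingKernel_hasCompactSupport (κ : ℝ) : HasCompactSupport (reproducingKernel κ) :=
  HasCompactSupport.intro (isCompact_setOf_smul_x₀_mem isCompact_setOf_nsq_le_quarter)
    fun u hu => by
      simp only [Set.mem_setOf_eq, not_le] at hu
      exact reproducingKernel_eq_zero hu.le

/-- `coT` along the stabiliser: `coT (k u) x₀ = (Jac k⁻¹ x₀)ᵀ · coT u x₀` (the Jacobian of `k` is constant). [cite: Borel1997, §5.14] -/
theorem coT_stabilizer_mul (k : stabilizer U21 x₀) (u : U21) :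
    coT ((k : U21) * u) x₀ = (Jac ((k : U21)⁻¹) x₀)ᵀ * coT u x₀ := by
  -- both sides are left inverses of `(Jac (k u) x₀)ᵀ`
  have h1 : coT ((k : U21) * u) x₀ * (Jac ((k : U21) * u) x₀)ᵀ = 1 := coT_mul_transpose_Jac _ _
  have hk : (k : U21)⁻¹ • x₀ = x₀ := mem_stabilizer_iff.mp (inv_mem k.2)
  have h2 : (Jac ((k : U21)⁻¹) x₀)ᵀ * coT u x₀ * (Jac ((k : U21) * u) x₀)ᵀ = 1 := by
    rw [BallForms.transpose_Jac_mul, Matrix.mul_assoc, ← Matrix.mul_assoc (coT u x₀), coT_mul_transpose_Jac,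
      Matrix.one_mul, ← transpose_mul, Jac_eq_Jac_x₀_of_mem_stabilizer k (u • x₀)]
    have h3 : Jac (k : U21) x₀ * Jac ((k : U21)⁻¹) x₀ = 1 := by
      have := Jac_mul (k : U21) ((k : U21)⁻¹) x₀
      rw [mul_inv_cancel, Jac_one, hk] at this
      exact this.symm
    rw [h3, transpose_one]
  have hinv : IsUnit (Jac ((k : U21) * u) x₀)ᵀ :=
    (Matrix.isUnit_iff_isUnit_det _).2 (by rw [det_transpose]; exact isUnit_iff_ne_zero.2 (det_Jac_ne_zero _ _))
  exact (hinv.mul_left_injective (h1.trans h2.symm))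

/-- **`K`-equivariance of the kernel**: `A_κ(k u) v = τ(k) (A_κ(u) v)`, `τ = weightOf x₀` the cotangent weight. [cite: Borel1997, §5.14] -/
theorem reproducingKernel_equivariant (κ : ℝ) (k : stabilizer U21 x₀) (u : U21) (v : Fin 2 → ℂ) :
    reproducingKernel κ ((k : U21) * u) *ᵥ v =
      BallForms.isPullbackCocycle_cotangentCocycle.weightOf x₀ k (reproducingKernel κ u *ᵥ v) := by
  rw [IsPullbackCocycle.weightOf_apply, BallForms.cotangentCocycle_apply, reproducingKernel,
    reproducingKernel, mul_smul, ballWeight_stabilizer_smul, coT_stabilizer_mul, smul_mulVec, smul_mulVec,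
    ← mulVec_mulVec, mulVec_smul]

/-! ## §3 The profile constant -/

/-- **The profile constant** `C_β = ∫_{ℂ²} β(|w|²) dw`. [cite: Borel1997, §5.14] -/
def profileIntegral : ℝ := ∫ w : Fin 2 → ℂ, bumpProfile (nsq w)

/-- `|·|²` is continuous on `ℂ²`. [cite: Rudin1980, §1.4] -/
theorem continuous_nsq : Continuous (nsq : (Fin 2 → ℂ) → ℝ) := by
  unfold nsq; fun_prop

/-- `w ↦ β(|w|²)` has compact support (inside the closed sup-norm unit ball). [cite: Rudin1980, §1.4] -/
theorem hasCompactSupport_bumpProfile_nsq : HasCompactSupport fun w : Fin 2 → ℂ => bumpProfile (nsq w) := by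
  refine HasCompactSupport.intro (isCompact_closedBall (0 : Fin 2 → ℂ) 1) fun w hw => bumpProfile_eq_zero ?_
  rw [Metric.mem_closedBall, dist_zero_right, not_le] at hw
  obtain ⟨i, hi⟩ : ∃ i, 1 < ‖w i‖ := by
    by_contra h
    push Not at h
    exact (lt_irrefl _) (hw.trans_le ((pi_norm_le_iff_of_nonneg zero_le_one).2 h))
  unfold nsq
  fin_cases i
  · change 1 < ‖w 0‖ at hi; nlinarith [norm_nonneg (w 1)]
  · change 1 < ‖w 1‖ at hi; nlinarith [norm_nonneg (w 0)]

/-- **`C_β > 0`** (`β ∘ |·|²` is continuous, non-negative, compactly supported and `= 1` at the origin). [cite: Rudin1980, §1.4] -/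
theorem profileIntegral_pos : 0 < profileIntegral := by
  refine Continuous.integral_pos_of_hasCompactSupport_nonneg_nonzero (x := (0 : Fin 2 → ℂ))
    (bumpProfile_continuous.comp continuous_nsq) hasCompactSupport_bumpProfile_nsq (fun w => bumpProfile_nonneg _) ?_
  have h0 : nsq (0 : Fin 2 → ℂ) = 0 := by simp [nsq]
  rw [h0, bumpProfile_eq_one (by norm_num)]
  exact one_ne_zero

/-! ## §4 Smoothness: the kernel is the restriction of a smooth matrix function of the entries -/

section Smooth

open scoped Matrix.Norms.Operator
open scoped ContDiff

/-- entries are `ℂ`-smooth. [cite: Borel1997, §5.14] -/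
theorem contDiffAt_entry {m n : Type} [Fintype m] [Fintype n] [DecidableEq m] [DecidableEq n] (i : m) (j : n)
    {k : WithTop ℕ∞} (N : Matrix m n ℂ) : ContDiffAt ℂ k (fun M : Matrix m n ℂ => M i j) N :=
  (entryL i j).contDiff.contDiffAt

/-- `qAt0 i j` is `ℂ`-smooth where `N₂₂ ≠ 0`. [cite: Borel1997, §5.14] -/
theorem contDiffAt_qAt0 (i j : Fin 2) {N : Matrix (Fin 3) (Fin 3) ℂ} (hN : N 2 2 ≠ 0) :
    ContDiffAt ℂ ∞ (qAt0 i j) N := by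
  unfold qAt0
  exact (((contDiffAt_entry _ _ N).mul (contDiffAt_entry _ _ N)).sub
    ((contDiffAt_entry _ _ N).mul (contDiffAt_entry _ _ N))).div
    ((contDiffAt_entry _ _ N).mul (contDiffAt_entry _ _ N)) (mul_ne_zero hN hN)

/-- `JacAt0` is `ℂ`-smooth where `N₂₂ ≠ 0`. [cite: Borel1997, §5.14] -/
theorem contDiffAt_JacAt0 {N : Matrix (Fin 3) (Fin 3) ℂ} (hN : N 2 2 ≠ 0) : ContDiffAt ℂ ∞ JacAt0 N := by
  unfold JacAt0
  exact ContDiffAt.sum fun p _ => (contDiffAt_qAt0 p.1 p.2 hN).smul contDiffAt_const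

/-- `coTOf` is `ℂ`-smooth where the determinant is non-zero. [cite: Borel1997, §5.14] -/
theorem contDiffAt_coTOf {P : Matrix (Fin 2) (Fin 2) ℂ} (hP : P 0 0 * P 1 1 - P 0 1 * P 1 0 ≠ 0) :
    ContDiffAt ℂ ∞ coTOf P := by
  unfold coTOf
  refine ContDiffAt.smul (((((contDiffAt_entry _ _ P).mul (contDiffAt_entry _ _ P)).sub
    ((contDiffAt_entry _ _ P).mul (contDiffAt_entry _ _ P))).inv hP)) ?_
  exact ((((contDiffAt_entry _ _ P).smul contDiffAt_const).sub ((contDiffAt_entry _ _ P).smul contDiffAt_const)).sub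
    ((contDiffAt_entry _ _ P).smul contDiffAt_const)).add ((contDiffAt_entry _ _ P).smul contDiffAt_const)

/-- `orbitVec` is `ℂ`-smooth where `N₂₂ ≠ 0`. [cite: Borel1997, §5.14] -/
theorem contDiffAt_orbitVec {N : Matrix (Fin 3) (Fin 3) ℂ} (hN : N 2 2 ≠ 0) : ContDiffAt ℂ ∞ orbitVec N := by
  unfold orbitVec
  exact contDiffAt_pi.2 fun i => (contDiffAt_entry _ _ N).mul ((contDiffAt_entry _ _ N).inv hN)

/-- `|·|²` on `ℂ²` is real-smooth. [cite: Borel1997, §5.14] -/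
theorem contDiff_nsq : ContDiff ℝ ∞ (nsq : (Fin 2 → ℂ) → ℝ) := by
  unfold nsq
  exact ((contDiff_apply ℝ ℂ (0 : Fin 2)).norm_sq ℝ).add ((contDiff_apply ℝ ℂ (1 : Fin 2)).norm_sq ℝ)

/-- **The extrinsic kernel** `Ã_κ(M) = (κ β(q) (1−q)³/9) • coTOf (JacAt0 M)`, `q = |orbitVec M|²`, on `M₃(ℂ)`. [cite: Borel1997, §5.14] -/
def extKernel (κ : ℝ) (M : Matrix (Fin 3) (Fin 3) ℂ) : Matrix (Fin 2) (Fin 2) ℂ :=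
  ((κ * (bumpProfile (nsq (orbitVec M)) * (1 - nsq (orbitVec M)) ^ 3 / 9) : ℝ) : ℂ) • coTOf (JacAt0 M)

/-- `A_κ = Ã_κ ∘ mat` on `U(2,1)`. [cite: Borel1997, §5.14] -/
theorem reproducingKernel_eq_extKernel (κ : ℝ) (u : U21) : reproducingKernel κ u = extKernel κ (mat u) := by
  have hq : nsq (orbitVec (mat u)) < 1 := by rw [← coe_smul_x₀]; exact (u • x₀).2
  have hw : ballWeight (u • x₀) = bumpProfile (nsq (orbitVec (mat u))) * (1 - nsq (orbitVec (mat u))) ^ 3 / 9 := by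
    unfold ballWeight bergmanDensity
    rw [coe_smul_x₀]
    have h1 : (1 - nsq (orbitVec (mat u))) ≠ 0 := by linarith
    field_simp
  rw [reproducingKernel, extKernel, hw, coT_eq_coTOf, Jac_x₀_eq, mul_div_assoc]

/-- `Ã_κ` is real-smooth at every point of `mat(U(2,1))`. [cite: Borel1997, §5.14] -/
theorem contDiffAt_extKernel (κ : ℝ) (u : U21) : ContDiffAt ℝ ∞ (extKernel κ) (mat u) := by
  have h22 : mat u 2 2 ≠ 0 := by
    have h := W3_2_ne_zero u x₀
    rwa [W3_x₀] at h
  have hdet : JacAt0 (mat u) 0 0 * JacAt0 (mat u) 1 1 - JacAt0 (mat u) 0 1 * JacAt0 (mat u) 1 0 ≠ 0 := by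
    rw [← Matrix.det_fin_two, ← Jac_x₀_eq]
    exact det_Jac_ne_zero u x₀
  have hJ : ContDiffAt ℝ ∞ (fun M => coTOf (JacAt0 M)) (mat u) :=
    ((contDiffAt_coTOf hdet).comp _ (contDiffAt_JacAt0 h22)).restrict_scalars ℝ
  have hq : ContDiffAt ℝ ∞ (fun M : Matrix (Fin 3) (Fin 3) ℂ => nsq (orbitVec M)) (mat u) :=
    contDiff_nsq.contDiffAt.comp _ ((contDiffAt_orbitVec h22).restrict_scalars ℝ)
  have hs : ContDiffAt ℝ ∞ (fun M : Matrix (Fin 3) (Fin 3) ℂ =>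
      κ * (bumpProfile (nsq (orbitVec M)) * (1 - nsq (orbitVec M)) ^ 3 / 9)) (mat u) :=
    contDiffAt_const.mul (((bumpProfile_contDiff.contDiffAt.comp _ hq).mul
      ((contDiffAt_const.sub hq).pow 3)).div_const 9)
  have hsC : ContDiffAt ℝ ∞ (fun M : Matrix (Fin 3) (Fin 3) ℂ =>
      (((κ * (bumpProfile (nsq (orbitVec M)) * (1 - nsq (orbitVec M)) ^ 3 / 9)) : ℝ) : ℂ)) (mat u) :=
    Complex.ofRealCLM.contDiff.contDiffAt.comp _ hs
  unfold extKernel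
  exact hsC.smul hJ

end Smooth
end Literature.AlgebraicGeometry.ShimuraVarieties.BallForms

end
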